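import Literature.MathematicalPhysics.QuantumLattice.ThermalPropagatorDysonEquation
import Literature.MathematicalPhysics.QuantumLattice.DWaveSourceDysonSeries
import Literature.MathematicalPhysics.QuantumLattice.HubbardTorusSingleScalePressure
import HarnessLib

/-!
# The free thermal kernel of the Shiba-transformed (Nambu) torus: spin-involution calculus and decay

The one-body operator of the Shiba/Lieb-transformed `d`-wave–sourced Hubbard torus
(`DWaveSourceDysonSeries.shibaOneBody τ_L Δ_h μ U = bdgNambuMatrix τ_L Δ_h μ + U·P_↑`) is, at zero
source and zero Hartree term, `h₀ = bdgNambuMatrix τ_L 0 μ = h_L · S`: the free Hubbard one-body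
operator `h_L = hubbardOneBody (fermionTorusGraph 2 L) 1 μ` times the spin involution `S = P_↑ - P_↓`
(the spin-down band particle–hole reversed), with `[h_L, P_↑] = 0`. This file computes the thermal
kernel `Γ_{h₀}(τ) = e^{-τh₀}(1 + e^{-βh₀})⁻¹` of such an operator along the involution and bounds its
entries by the uniform-in-`L` decay of the free Hubbard propagator — the input `hΓ₀` of the stability
theorem `Matrix.norm_thermalKernel_apply_le_of_subconvolutive` (ThermalPropagatorDysonEquation) for the
sourced expansion around the BdG–Shiba propagator.

§1 (generic, any idempotent `P` commuting with `X`, `Q = 1 - P`, `S = P - Q`):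
* `pow_smul_mul_spinInvolution` — `(t·XS)ⁿ = (tX)ⁿ P + (-tX)ⁿ Q`;
* `exp_smul_mul_spinInvolution` — `e^{tXS} = e^{tX} P + e^{-tX} Q`;
* `inv_one_add_exp_smul_mul_spinInvolution` — `(1 + e^{bXS})⁻¹ = (1+e^{bX})⁻¹ P + (1+e^{-bX})⁻¹ Q`
  (given the two inverses exist);
* `thermalKernel_mul_spinInvolution` — `Γ_{XS}(τ) = e^{-τX}(1+e^{-βX})⁻¹ P + e^{τX}(1+e^{βX})⁻¹ Q`.

§2 (the torus):
* `bdgNambuMatrix_zero_eq_hubbardOneBody_mul` — `bdgNambuMatrix τ_G 0 μ = hubbardOneBody G 1 μ · S` for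
  every finite graph (`τ_G = -[x ∼ y]`), `hubbardOneBody_mul_spinUpProj_comm`, `spinUpProj_mul_self`;
* **`norm_shibaFreeKernel_apply_le`** — with the decay data `(C, K)` of
  `exists_norm_hubbardThermalTwoPointEvolved_le_tnZ` (separations `[-2β, β]`), for all `L ≥ 3`,
  `τ ∈ [0, β]`, orbitals `(v, σ'), (u, σ)`:
  `‖Γ_{h₀}(τ) (v,σ') (u,σ)‖ ≤ C (1 + |v̄ - ū|_L)^{-K}` (torus norm).

Everything is PROVED; no definition and no named fact.

## References

* H. Shiba, Prog. Theor. Phys. 48 (1972) 2171–2186, §2. [cite: Shiba1972, §2]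
* E. H. Lieb, Phys. Rev. Lett. 62 (1989) 1201–1204, proof of Thm 2. [cite: Lieb1989, proof of Theorem 2]
* G. Benfatto, A. Giuliani, V. Mastropietro, Ann. Henri Poincaré 7 (2006) 809–898, §2.1 (1.4), §2.2.
  [cite: BenfattoGiulianiMastropietro2006, §2.2]
-/

noncomputable section

open scoped Matrix.Norms.L2Operator ComplexOrder
open Finset MeasureTheory Filter Topology NormedSpace Set
open Literature.Probability.LatticeModels

namespace Literature.MathematicalPhysics.QuantumLattice

/-! ### §1 Functional calculus along a commuting idempotent -/

section Involution

variable {ι : Type*} [LinearOrder ι] [Fintype ι] {X P : Matrix ι ι ℂ}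

/-- **Powers along the involution**: if `P² = P` and `XP = PX` then
`(t·X(P - (1-P)))ⁿ = (tX)ⁿ P + ((-t)X)ⁿ (1 - P)`. [folklore] -/
theorem pow_smul_mul_spinInvolution (hP : P * P = P) (hXP : X * P = P * X) (t : ℂ) :
    ∀ n : ℕ, (t • (X * (P - (1 - P)))) ^ n = (t • X) ^ n * P + ((-t) • X) ^ n * (1 - P)
  | 0 => by rw [pow_zero, pow_zero, pow_zero, one_mul, one_mul, add_sub_cancel]
  | n + 1 => by
    set A : Matrix ι ι ℂ := t • X with hA
    set Q : Matrix ι ι ℂ := 1 - P with hQ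
    have hB : (-t) • X = -A := by rw [hA, neg_smul]
    have hAP : P * A = A * P := by rw [hA, mul_smul_comm, smul_mul_assoc, hXP]
    have hPQ : P * Q = 0 := by rw [hQ, mul_sub, mul_one, hP, sub_self]
    have hQP : Q * P = 0 := by rw [hQ, sub_mul, one_mul, hP, sub_self]
    have hQQ : Q * Q = Q := by rw [hQ, mul_sub, sub_mul, one_mul, mul_one, sub_mul, one_mul, hP, sub_self, sub_zero]
    have hAQ : Q * A = A * Q := by rw [hQ, sub_mul, mul_sub, one_mul, mul_one, hAP]
    have hexp : t • (X * (P - (1 - P))) = A * P - A * Q := by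
      simp only [hA, hQ, mul_sub, smul_sub, smul_mul_assoc]
    rw [pow_succ, pow_smul_mul_spinInvolution hP hXP t n, hB, hexp]
    rw [show (-A) ^ (n + 1) = (-A) ^ n * (-A) from pow_succ _ _]
    calc ((A ^ n * P + (-A) ^ n * Q) * (A * P - A * Q) : Matrix ι ι ℂ)
        = A ^ n * (P * A) * P - A ^ n * (P * A) * Q + (-A) ^ n * (Q * A) * P
            - (-A) ^ n * (Q * A) * Q := by noncomm_ring
      _ = A ^ n * (A * P) * P - A ^ n * (A * P) * Q + (-A) ^ n * (A * Q) * P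
            - (-A) ^ n * (A * Q) * Q := by rw [hAP, hAQ]
      _ = A ^ n * A * (P * P) - A ^ n * A * (P * Q) + (-A) ^ n * A * (Q * P)
            - (-A) ^ n * A * (Q * Q) := by noncomm_ring
      _ = A ^ n * A * P + (-A) ^ n * (-A) * Q := by
          rw [hP, hPQ, hQP, hQQ]; noncomm_ring

/-- **The exponential along the involution**: `e^{tX(P - (1-P))} = e^{tX} P + e^{-tX} (1 - P)`.
[folklore] -/
theorem exp_smul_mul_spinInvolution (hP : P * P = P) (hXP : X * P = P * X) (t : ℂ) :
    exp (t • (X * (P - (1 - P)))) = exp (t • X) * P + exp ((-t) • X) * (1 - P) := by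
  have hs₁ : Summable fun n : ℕ => ((n.factorial : ℂ)⁻¹ • (t • X) ^ n) :=
    expSeries_summable' (𝕂 := ℂ) (t • X)
  have hs₂ : Summable fun n : ℕ => ((n.factorial : ℂ)⁻¹ • ((-t) • X) ^ n) :=
    expSeries_summable' (𝕂 := ℂ) ((-t) • X)
  have hterm : ∀ n : ℕ, (n.factorial : ℂ)⁻¹ • (t • (X * (P - (1 - P)))) ^ n =
      ((n.factorial : ℂ)⁻¹ • (t • X) ^ n) * P + ((n.factorial : ℂ)⁻¹ • ((-t) • X) ^ n) * (1 - P) := by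
    intro n
    rw [pow_smul_mul_spinInvolution hP hXP t n, smul_add, smul_mul_assoc, smul_mul_assoc]
  rw [congrFun (exp_eq_tsum ℂ) (t • (X * (P - (1 - P)))), congrFun (exp_eq_tsum ℂ) (t • X),
    congrFun (exp_eq_tsum ℂ) ((-t) • X)]
  simp only [hterm]
  rw [Summable.tsum_add (hs₁.mul_right P) (hs₂.mul_right (1 - P)), hs₁.tsum_mul_right, hs₂.tsum_mul_right]

/-- `P` commutes with the inverse of a matrix it commutes with. [folklore] -/
theorem mul_inv_comm_of_commute {A P : Matrix ι ι ℂ} (hU : IsUnit A.det) (hAP : A * P = P * A) :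
    A⁻¹ * P = P * A⁻¹ := by
  calc A⁻¹ * P = A⁻¹ * P * (A * A⁻¹) := by rw [Matrix.mul_nonsing_inv _ hU, mul_one]
    _ = A⁻¹ * (P * A) * A⁻¹ := by simp only [mul_assoc]
    _ = A⁻¹ * (A * P) * A⁻¹ := by rw [hAP]
    _ = P * A⁻¹ := by rw [← mul_assoc, Matrix.nonsing_inv_mul _ hU, one_mul]

/-- **The Fermi factor along the involution**: if `1 + e^{bX}` and `1 + e^{-bX}` are invertible,
`(1 + e^{bX(P-(1-P))})⁻¹ = (1 + e^{bX})⁻¹ P + (1 + e^{-bX})⁻¹ (1 - P)`. [folklore] -/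
theorem inv_one_add_exp_smul_mul_spinInvolution (hP : P * P = P) (hXP : X * P = P * X) (b : ℂ)
    (hU₁ : IsUnit (1 + exp (b • X)).det) (hU₂ : IsUnit (1 + exp ((-b) • X)).det) :
    (1 + exp (b • (X * (P - (1 - P)))))⁻¹ =
      (1 + exp (b • X))⁻¹ * P + (1 + exp ((-b) • X))⁻¹ * (1 - P) := by
  set Q : Matrix ι ι ℂ := 1 - P with hQ
  set A₁ : Matrix ι ι ℂ := 1 + exp (b • X) with hA₁
  set A₂ : Matrix ι ι ℂ := 1 + exp ((-b) • X) with hA₂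
  have hPQ : P * Q = 0 := by rw [hQ, mul_sub, mul_one, hP, sub_self]
  have hQP : Q * P = 0 := by rw [hQ, sub_mul, one_mul, hP, sub_self]
  have hQQ : Q * Q = Q := by rw [hQ, mul_sub, sub_mul, one_mul, mul_one, sub_mul, one_mul, hP, sub_self, sub_zero]
  -- `P` commutes with `e^{cX}` and with `A₁, A₂`
  have hexpP : ∀ c : ℂ, exp (c • X) * P = P * exp (c • X) := by
    intro c
    have hpow : ∀ n : ℕ, (c • X) ^ n * P = P * (c • X) ^ n := by
      intro n
      induction n with
      | zero => rw [pow_zero, one_mul, mul_one]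
      | succ n ih =>
          rw [pow_succ, mul_assoc, show c • X * P = P * (c • X) by
            rw [smul_mul_assoc, hXP, mul_smul_comm], ← mul_assoc, ih, mul_assoc]
    have hs : Summable fun n : ℕ => ((n.factorial : ℂ)⁻¹ • (c • X) ^ n) :=
      expSeries_summable' (𝕂 := ℂ) (c • X)
    rw [congrFun (exp_eq_tsum ℂ) (c • X), ← hs.tsum_mul_right, ← hs.tsum_mul_left]
    exact tsum_congr fun n => by rw [smul_mul_assoc, hpow, mul_smul_comm]
  have hA₁P : A₁ * P = P * A₁ := by rw [hA₁, add_mul, mul_add, one_mul, mul_one, hexpP]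
  have hA₂P : A₂ * P = P * A₂ := by rw [hA₂, add_mul, mul_add, one_mul, mul_one, hexpP]
  have hA₁Q : A₁ * Q = Q * A₁ := by rw [hQ, mul_sub, sub_mul, mul_one, one_mul, hA₁P]
  have hA₂Q : A₂ * Q = Q * A₂ := by rw [hQ, mul_sub, sub_mul, mul_one, one_mul, hA₂P]
  have hinv₁ : A₁⁻¹ * P = P * A₁⁻¹ := mul_inv_comm_of_commute hU₁ hA₁P
  have hinv₂ : A₂⁻¹ * Q = Q * A₂⁻¹ := mul_inv_comm_of_commute hU₂ hA₂Q
  -- `1 + e^{bXS} = A₁ P + A₂ Q`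
  have hsum : 1 + exp (b • (X * (P - (1 - P)))) = A₁ * P + A₂ * Q := by
    rw [exp_smul_mul_spinInvolution hP hXP b, hA₁, hA₂, hQ]
    noncomm_ring
  rw [hsum]
  refine Matrix.inv_eq_right_inv ?_
  calc (A₁ * P + A₂ * Q) * (A₁⁻¹ * P + A₂⁻¹ * Q)
      = A₁ * (P * A₁⁻¹) * P + A₁ * (P * A₂⁻¹) * Q + A₂ * (Q * A₁⁻¹) * P + A₂ * (Q * A₂⁻¹) * Q := by
        noncomm_ring
    _ = A₁ * (A₁⁻¹ * P) * P + A₁ * (P * A₂⁻¹) * Q + A₂ * (Q * A₁⁻¹) * P + A₂ * (A₂⁻¹ * Q) * Q := by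
        rw [hinv₁, hinv₂]
    _ = (A₁ * A₁⁻¹) * (P * P) + A₁ * P * (A₂⁻¹ * Q) + A₂ * Q * (A₁⁻¹ * P) + (A₂ * A₂⁻¹) * (Q * Q) := by
        noncomm_ring
    _ = (A₁ * A₁⁻¹) * (P * P) + A₁ * P * (Q * A₂⁻¹) + A₂ * Q * (P * A₁⁻¹) + (A₂ * A₂⁻¹) * (Q * Q) := by
        rw [hinv₁, hinv₂]
    _ = P + Q := by
        rw [Matrix.mul_nonsing_inv _ hU₁, Matrix.mul_nonsing_inv _ hU₂, hP, hQQ, one_mul, one_mul,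
          mul_assoc A₁, ← mul_assoc P Q, hPQ, zero_mul, mul_zero, add_zero,
          mul_assoc A₂, ← mul_assoc Q P, hQP, zero_mul, mul_zero, add_zero]
    _ = 1 := by rw [hQ, add_sub_cancel]

/-- **The thermal kernel along the involution**: for Hermitian `X`, an idempotent `P` commuting with
it and real `β, τ`,
`e^{-τX(P-(1-P))}(1 + e^{-βX(P-(1-P))})⁻¹ = e^{-τX}(1+e^{-βX})⁻¹ P + e^{τX}(1+e^{βX})⁻¹ (1 - P)`:
the spin-up block is the particle kernel of `X`, the spin-down block its hole kernel. [folklore] -/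
theorem thermalKernel_mul_spinInvolution (hX : X.IsHermitian) (hP : P * P = P) (hXP : X * P = P * X)
    (β τ : ℝ) :
    exp ((-τ) • (X * (P - (1 - P)))) * (1 + exp ((-β) • (X * (P - (1 - P)))))⁻¹ =
      exp ((-τ) • X) * (1 + exp ((-β) • X))⁻¹ * P + exp (τ • X) * (1 + exp (β • X))⁻¹ * (1 - P) := by
  set Q : Matrix ι ι ℂ := 1 - P with hQ
  have hPQ : P * Q = 0 := by rw [hQ, mul_sub, mul_one, hP, sub_self]
  have hQP : Q * P = 0 := by rw [hQ, sub_mul, one_mul, hP, sub_self]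
  have hQQ : Q * Q = Q := by rw [hQ, mul_sub, sub_mul, one_mul, mul_one, sub_mul, one_mul, hP, sub_self, sub_zero]
  have hU₁ : IsUnit (1 + exp ((-β) • X)).det := Matrix.isUnit_det_one_add_exp_smul hX (-β)
  have hU₂ : IsUnit (1 + exp (β • X)).det := Matrix.isUnit_det_one_add_exp_smul hX β
  -- real scalars as complex scalars
  have hτc : ((-τ : ℝ) : ℂ) • (X * (P - Q)) = (-τ) • (X * (P - Q)) := Complex.coe_smul _ _
  have hβc : ((-β : ℝ) : ℂ) • (X * (P - Q)) = (-β) • (X * (P - Q)) := Complex.coe_smul _ _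
  have hE : exp ((-τ) • (X * (P - Q))) = exp ((-τ) • X) * P + exp (τ • X) * Q := by
    rw [← hτc, exp_smul_mul_spinInvolution hP hXP, Complex.coe_smul, show -((-τ : ℝ) : ℂ) = ((τ : ℝ) : ℂ) by
      push_cast; ring, Complex.coe_smul]
  have hF : (1 + exp ((-β) • (X * (P - Q))))⁻¹ =
      (1 + exp ((-β) • X))⁻¹ * P + (1 + exp (β • X))⁻¹ * Q := by
    have hU₁' : IsUnit (1 + exp (((-β : ℝ) : ℂ) • X)).det := by rwa [Complex.coe_smul]
    have hU₂' : IsUnit (1 + exp ((-((-β : ℝ) : ℂ)) • X)).det := by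
      rwa [show -((-β : ℝ) : ℂ) = ((β : ℝ) : ℂ) by push_cast; ring, Complex.coe_smul]
    rw [← hβc, inv_one_add_exp_smul_mul_spinInvolution hP hXP _ hU₁' hU₂', Complex.coe_smul,
      show -((-β : ℝ) : ℂ) = ((β : ℝ) : ℂ) by push_cast; ring, Complex.coe_smul]
  -- `P` commutes with the Fermi factors
  have hexpP : ∀ c : ℝ, exp (c • X) * P = P * exp (c • X) := by
    intro c
    have h := congrArg (fun M => M * P) (exp_smul_mul_spinInvolution hP hXP (c : ℂ))
    -- cheaper: use the power-series commutation through the generic lemma with `b := c`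
    have hpow : ∀ n : ℕ, ((c : ℂ) • X) ^ n * P = P * ((c : ℂ) • X) ^ n := by
      intro n
      induction n with
      | zero => rw [pow_zero, one_mul, mul_one]
      | succ n ih =>
          rw [pow_succ, mul_assoc, show (c : ℂ) • X * P = P * ((c : ℂ) • X) by
            rw [smul_mul_assoc, hXP, mul_smul_comm], ← mul_assoc, ih, mul_assoc]
    have hs : Summable fun n : ℕ => ((n.factorial : ℂ)⁻¹ • ((c : ℂ) • X) ^ n) :=
      expSeries_summable' (𝕂 := ℂ) ((c : ℂ) • X)
    rw [← Complex.coe_smul, congrFun (exp_eq_tsum ℂ) ((c : ℂ) • X), ← hs.tsum_mul_right,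
      ← hs.tsum_mul_left]
    exact tsum_congr fun n => by rw [smul_mul_assoc, hpow, mul_smul_comm]
  have hF₁P : (1 + exp ((-β) • X))⁻¹ * P = P * (1 + exp ((-β) • X))⁻¹ :=
    mul_inv_comm_of_commute hU₁ (by rw [add_mul, mul_add, one_mul, mul_one, hexpP])
  have hF₂Q : (1 + exp (β • X))⁻¹ * Q = Q * (1 + exp (β • X))⁻¹ := by
    refine mul_inv_comm_of_commute hU₂ ?_
    rw [hQ, mul_sub, sub_mul, mul_one, one_mul, add_mul, mul_add, one_mul, mul_one, hexpP]
  rw [hE, hF]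
  calc (exp ((-τ) • X) * P + exp (τ • X) * Q) * ((1 + exp ((-β) • X))⁻¹ * P + (1 + exp (β • X))⁻¹ * Q)
      = exp ((-τ) • X) * (P * (1 + exp ((-β) • X))⁻¹) * P + exp ((-τ) • X) * (P * (1 + exp (β • X))⁻¹) * Q
        + exp (τ • X) * (Q * (1 + exp ((-β) • X))⁻¹) * P + exp (τ • X) * (Q * (1 + exp (β • X))⁻¹) * Q := by
        noncomm_ring
    _ = exp ((-τ) • X) * ((1 + exp ((-β) • X))⁻¹ * P) * P + exp ((-τ) • X) * (P * (1 + exp (β • X))⁻¹) * Q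
        + exp (τ • X) * (Q * (1 + exp ((-β) • X))⁻¹) * P + exp (τ • X) * ((1 + exp (β • X))⁻¹ * Q) * Q := by
        rw [hF₁P, hF₂Q]
    _ = exp ((-τ) • X) * (1 + exp ((-β) • X))⁻¹ * (P * P)
        + exp ((-τ) • X) * P * ((1 + exp (β • X))⁻¹ * Q)
        + exp (τ • X) * Q * ((1 + exp ((-β) • X))⁻¹ * P)
        + exp (τ • X) * (1 + exp (β • X))⁻¹ * (Q * Q) := by noncomm_ring
    _ = exp ((-τ) • X) * (1 + exp ((-β) • X))⁻¹ * (P * P)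
        + exp ((-τ) • X) * P * (Q * (1 + exp (β • X))⁻¹)
        + exp (τ • X) * Q * (P * (1 + exp ((-β) • X))⁻¹)
        + exp (τ • X) * (1 + exp (β • X))⁻¹ * (Q * Q) := by rw [hF₁P, hF₂Q]
    _ = exp ((-τ) • X) * (1 + exp ((-β) • X))⁻¹ * P + exp (τ • X) * (1 + exp (β • X))⁻¹ * Q := by
        rw [hP, hQQ, mul_assoc (exp ((-τ) • X)) P, ← mul_assoc P Q, hPQ, zero_mul, mul_zero, add_zero,
          mul_assoc (exp (τ • X)) Q, ← mul_assoc Q P, hQP, zero_mul, mul_zero, add_zero]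

end Involution

/-! ### §2 The torus: `bdgNambuMatrix τ_G 0 μ = hubbardOneBody G 1 μ · S` and the decay of its kernel -/

section Torus

variable {Λ : Type*} [LinearOrder Λ] [Fintype Λ] (G : SimpleGraph Λ) [DecidableRel G.Adj]

/-- The spin-up projection is idempotent. [folklore] -/
theorem spinUpProj_mul_self :
    (Matrix.diagonal (fun o : Orb Λ => if (ofLex o).2 = 0 then (1 : ℂ) else 0)) *
        Matrix.diagonal (fun o : Orb Λ => if (ofLex o).2 = 0 then (1 : ℂ) else 0) =
      Matrix.diagonal (fun o : Orb Λ => if (ofLex o).2 = 0 then (1 : ℂ) else 0) := by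
  rw [Matrix.diagonal_mul_diagonal]
  congr 1
  funext o
  split_ifs <;> simp

/-- The free Hubbard one-body matrix is spin-diagonal: it commutes with the spin-up projection.
[folklore] -/
theorem hubbardOneBody_mul_spinUpProj_comm (t μ : ℝ) :
    hubbardOneBody G t μ * Matrix.diagonal (fun o : Orb Λ => if (ofLex o).2 = 0 then (1 : ℂ) else 0) =
      Matrix.diagonal (fun o : Orb Λ => if (ofLex o).2 = 0 then (1 : ℂ) else 0) * hubbardOneBody G t μ := by
  ext o o'
  rw [Matrix.mul_diagonal, Matrix.diagonal_mul, hubbardOneBody_apply]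
  by_cases hs : (ofLex o).2 = (ofLex o').2
  · rw [hs]
    split_ifs <;> ring
  · have ho : o ≠ o' := fun h => hs (by rw [h])
    simp only [hs, and_false, if_false, ho, sub_self, zero_mul, mul_zero]

/-- **The Nambu matrix at zero pairing is the free one-body matrix times the spin involution**:
`bdgNambuMatrix τ_G 0 μ = hubbardOneBody G 1 μ · (P_↑ - P_↓)`, `τ_G(x,y) = -[x ∼ y]`. [folklore] -/
theorem bdgNambuMatrix_zero_eq_hubbardOneBody_mul (μ : ℝ) :
    bdgNambuMatrix (fun x y : Λ => if G.Adj x y then -(1 : ℂ) else 0) (fun _ _ => (0 : ℂ)) μ =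
      hubbardOneBody G 1 μ *
        (Matrix.diagonal (fun o : Orb Λ => if (ofLex o).2 = 0 then (1 : ℂ) else 0) -
          (1 - Matrix.diagonal (fun o : Orb Λ => if (ofLex o).2 = 0 then (1 : ℂ) else 0))) := by
  have hS : (Matrix.diagonal (fun o : Orb Λ => if (ofLex o).2 = 0 then (1 : ℂ) else 0) -
      (1 - Matrix.diagonal (fun o : Orb Λ => if (ofLex o).2 = 0 then (1 : ℂ) else 0))) =
      Matrix.diagonal (fun o : Orb Λ => if (ofLex o).2 = 0 then (1 : ℂ) else -1) := by
    rw [← Matrix.diagonal_one, Matrix.diagonal_sub, Matrix.diagonal_sub]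
    congr 1
    funext o
    split_ifs <;> norm_num
  rw [hS]
  ext o o'
  obtain ⟨⟨x, σ⟩, rfl⟩ : ∃ p : Λ × Fin 2, toLex p = o := ⟨ofLex o, toLex_ofLex o⟩
  obtain ⟨⟨y, σ'⟩, rfl⟩ : ∃ p : Λ × Fin 2, toLex p = o' := ⟨ofLex o', toLex_ofLex o'⟩
  rw [Matrix.mul_diagonal, show toLex (x, σ) = orb x σ from rfl, show toLex (y, σ') = orb y σ' from rfl,
    bdgNambuMatrix_orb_orb, hubbardOneBody_apply]
  simp only [orb, ofLex_toLex, add_zero, neg_zero, star_zero, Complex.ofReal_one, toLex_inj, Prod.mk.injEq]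
  fin_cases σ <;> fin_cases σ'
  · by_cases hxy : x = y <;> by_cases hA : G.Adj x y <;> simp [hxy, hA]
  · simp
  · simp
  · by_cases hxy : x = y <;> by_cases hA : G.Adj x y <;> simp [hxy, hA, G.adj_comm, eq_comm]

-- On the concrete orbital type `Orb (FermionTorus 2 L)` two `DecidableEq` instance paths meet (the
-- concrete `instDecidableEqLex` and the generic lemmas' `LinearOrder.toDecidableEq`, equal only
-- propositionally); we work on the generic path and bridge to the tree's torus lemmas by `convert`.
attribute [-instance] instDecidableEqLex

variable (β μ : ℝ) {L : ℕ} [NeZero L]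

/-- **Decay of the free Shiba/Nambu thermal kernel, uniformly in the volume.** With the decay data
`(C, K)` of the free Hubbard propagator for the separations `[-2β, β]`, for all `L ≥ 3`, `τ ∈ [0, β]`,
torus orbitals `(v, σ')`, `(u, σ)`: the `((v,σ'), (u,σ))` entry of
`e^{-τh₀}(1 + e^{-βh₀})⁻¹`, `h₀ = bdgNambuMatrix τ_L 0 μ`, is at most `C (1 + |v̄ - ū|_L)^{-K}` — the
spin-up block is `⟨a⁺_{u↑}(β-τ) a⁻_{v↑}(0)⟩_{β,L,0}`, the spin-down block `⟨a⁺_{u↓}(τ) a⁻_{v↓}(0)⟩_{β,L,0}`,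
the off-diagonal blocks vanish. [cite: BenfattoGiulianiMastropietro2006, §2.2] -/
theorem norm_shibaFreeKernel_apply_le (hβ : 0 ≤ β) {K : ℕ} {C : ℝ} (hC0 : 0 ≤ C)
    (hC : ∀ (L : ℕ), 3 ≤ L → ∀ (t s : ℝ), s - t ∈ Icc (-(2 * β)) β →
      ∀ (x₁ y₁ : Site 2) (σ₁ σ₂ : Fin 2),
        ‖hubbardThermalTwoPointEvolved β 0 μ L x₁ σ₁ (t : ℂ) y₁ σ₂ (s : ℂ)‖ ≤
          C * ((1 + (tnZ L (y₁ - x₁) : ℝ)) ^ K)⁻¹)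
    (hL : 3 ≤ L) {τ : ℝ} (hτ : τ ∈ Icc (0 : ℝ) β) (u v : FermionTorus 2 L) (σ σ' : Fin 2) :
    ‖(exp ((-τ) • bdgNambuMatrix (fun x y : FermionTorus 2 L =>
          if (fermionTorusGraph 2 L).Adj x y then -(1 : ℂ) else 0) (fun _ _ => (0 : ℂ)) μ) *
        (1 + exp ((-β) • bdgNambuMatrix (fun x y : FermionTorus 2 L =>
          if (fermionTorusGraph 2 L).Adj x y then -(1 : ℂ) else 0) (fun _ _ => (0 : ℂ)) μ))⁻¹)
        (orb v σ') (orb u σ)‖ ≤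
      C * ((1 + (Torus.tnorm (FermionTorus.toTorusSite v - FermionTorus.toTorusSite u) : ℝ)) ^ K)⁻¹ := by
  set X : Matrix (Orb (FermionTorus 2 L)) (Orb (FermionTorus 2 L)) ℂ :=
    hubbardOneBody (fermionTorusGraph 2 L) 1 μ with hX
  set P : Matrix (Orb (FermionTorus 2 L)) (Orb (FermionTorus 2 L)) ℂ :=
    Matrix.diagonal (fun o : Orb (FermionTorus 2 L) => if (ofLex o).2 = 0 then (1 : ℂ) else 0) with hP
  have hXh : X.IsHermitian := isHermitian_hubbardOneBody (fermionTorusGraph 2 L) 1 μ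
  have hPP : P * P = P := spinUpProj_mul_self
  have hXP : X * P = P * X := hubbardOneBody_mul_spinUpProj_comm (fermionTorusGraph 2 L) 1 μ
  have h0 : bdgNambuMatrix (fun x y : FermionTorus 2 L =>
      if (fermionTorusGraph 2 L).Adj x y then -(1 : ℂ) else 0) (fun _ _ => (0 : ℂ)) μ = X * (P - (1 - P)) :=
    bdgNambuMatrix_zero_eq_hubbardOneBody_mul (fermionTorusGraph 2 L) μ
  -- entries of `M * P` (spin-up columns survive)
  have hPapply : ∀ (M : Matrix (Orb (FermionTorus 2 L)) (Orb (FermionTorus 2 L)) ℂ),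
      (M * P) (orb v σ') (orb u σ) = if σ = 0 then M (orb v σ') (orb u σ) else 0 := by
    intro M
    rw [hP, Matrix.mul_diagonal]
    simp only [orb, ofLex_toLex, mul_ite, mul_one, mul_zero]
  rw [h0, thermalKernel_mul_spinInvolution hXh hPP hXP β τ, Matrix.add_apply, Matrix.mul_sub,
    Matrix.mul_one, Matrix.sub_apply, hPapply, hPapply]
  -- integer representatives of the torus sites
  set xu : Site 2 := Torus.cRep (FermionTorus.toTorusSite u) with hxu
  set xv : Site 2 := Torus.cRep (FermionTorus.toTorusSite v) with hxv
  have hu : FermionTorus.ofTorusSite (Torus.proj L xu) = u := by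
    rw [hxu, Torus.proj_cRep, FermionTorus.ofTorusSite_toTorusSite]
  have hv : FermionTorus.ofTorusSite (Torus.proj L xv) = v := by
    rw [hxv, Torus.proj_cRep, FermionTorus.ofTorusSite_toTorusSite]
  have htn : (tnZ L (xv - xu) : ℝ) =
      (Torus.tnorm (FermionTorus.toTorusSite v - FermionTorus.toTorusSite u) : ℝ) := by
    rw [tnZ, Torus.proj_sub, hxu, hxv, Torus.proj_cRep, Torus.proj_cRep]
  rw [← htn]
  -- the two Fermi kernels of `X` in the "creation-first" form of the bridge lemma
  have hF₂X : ∀ c : ℝ, exp (c • X) * (1 + exp (β • X))⁻¹ = (1 + exp (β • X))⁻¹ * exp (c • X) := fun c =>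
    (Matrix.inv_one_add_exp_smul_mul_exp_smul_comm hXh β c).symm
  have hup : exp ((-τ) • X) * (1 + exp ((-β) • X))⁻¹ =
      exp (-((0 : ℂ) • X)) * (1 + exp ((β : ℂ) • X))⁻¹ * exp (((β - τ : ℝ) : ℂ) • X) := by
    rw [zero_smul, neg_zero, exp_zero, one_mul, Complex.coe_smul, Complex.coe_smul]
    have h1 : (1 + exp ((-β) • X))⁻¹ = exp (β • X) * (1 + exp (β • X))⁻¹ := by
      have h := inv_one_add_exp_neg_smul hXh β
      rw [Complex.coe_smul, ← neg_smul] at h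
      exact h
    rw [h1, ← mul_assoc, ← Matrix.exp_add_of_commute _ _ (((Commute.refl X).smul_left _).smul_right _),
      ← add_smul, show -τ + β = β - τ by ring, hF₂X]
  have hdown : exp (τ • X) * (1 + exp (β • X))⁻¹ =
      exp (-((0 : ℂ) • X)) * (1 + exp ((β : ℂ) • X))⁻¹ * exp (((τ : ℝ) : ℂ) • X) := by
    rw [zero_smul, neg_zero, exp_zero, one_mul, Complex.coe_smul, Complex.coe_smul, hF₂X]
  have hsep₁ : (0 : ℝ) - (β - τ) ∈ Icc (-(2 * β)) β := ⟨by linarith [hτ.1, hτ.2], by linarith [hτ.1, hτ.2]⟩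
  have hsep₂ : (0 : ℝ) - τ ∈ Icc (-(2 * β)) β := ⟨by linarith [hτ.1, hτ.2], by linarith [hτ.1, hτ.2]⟩
  have hpos : 0 ≤ C * ((1 + (tnZ L (xv - xu) : ℝ)) ^ K)⁻¹ := by positivity
  by_cases hσ : σ = 0
  · -- spin-up block: the particle kernel at time `β - τ`
    rw [if_pos hσ, if_pos hσ, sub_self, add_zero, hup, hσ]
    have e := fermi_evolve_apply_eq_hubbardThermalTwoPointEvolved (L := L) β μ xu xv 0 σ'
      (((β - τ : ℝ) : ℂ)) 0
    rw [hu, hv] at e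
    have key := hC L hL (β - τ) 0 hsep₁ xu xv 0 σ'
    rw [Complex.ofReal_zero, ← e] at key
    -- instance paths on `Orb (FermionTorus 2 L)` differ between the files: `convert`
    convert key using 10
  · -- spin-down block: the hole kernel at time `τ`
    rw [if_neg hσ, if_neg hσ, zero_add, sub_zero, hdown]
    have e := fermi_evolve_apply_eq_hubbardThermalTwoPointEvolved (L := L) β μ xu xv σ σ' ((τ : ℝ) : ℂ) 0
    rw [hu, hv] at e
    have key := hC L hL τ 0 hsep₂ xu xv σ σ'
    rw [Complex.ofReal_zero, ← e] at key
    convert key using 10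

end Torus

end Literature.MathematicalPhysics.QuantumLattice
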